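import Summits.Schanuel.Schanuel.Theorems.ZilberEacFibreCurvePuiseux
import Summits.Schanuel.Schanuel.Theorems.ZilberEacAlgebraicCurvesAll
import Summits.Schanuel.Schanuel.Theorems.ZilberEacRationalGraphFibres
import HarnessLib

/-!
# Arbitrary base branches, XCIII: FIBRE CURVES OVER CURVES DEFINED OVER `ℚ̄` ARE DENSE —
# Mantova–Masser's question for surfaces `{x ∈ C, P(x₀, x₁; y₀) = 0}` (O89)

HONEST FRAMING.  Cell `pub-schanuel` (Zilber's Exponential-Algebraic Closedness, case ladder;
host summit Schanuel), seat 2, gen 33.  Gen 32 (THE VERDICT, file LXXXVIII) decided the question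
for every surface `{F = 0, y₀ = R(x₀, x₁)}` over an irreducible `F ∈ ℚ̄[x₀][x₁]`; the surfaces
of the case fibred in CURVES, `{x ∈ C, P(x; y₀) = 0}` with `P` of `y₀`-degree `≥ 2`, were open
over general curves (decided over polynomial graphs, gen 26).  With the Puiseux parametrisation of
file XCII the germ theorems apply verbatim:
* **`unprojectedDense_fibreCurve_algebraicCurve_place`** — along an unbounded place of a curve over
  `ℚ̄` containing no line (file LXXXIII engine);
* **`unprojectedDense_fibreCurve_boundedPlace`** / **`…'`** — along a bounded place of ANY
  irreducible curve of `x₁`-degree `≥ 2` / `≥ 1` and not horizontal (file LXVII engines, no `ℚ̄`);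
* **`unprojectedDense_fibreCurve_algebraicCurve`** — THE HEADLINE: `F ∈ ℚ̄[x₀][x₁]` irreducible of
  positive `x₁`-degree and not a line, `P ∈ ℂ[x₀, x₁][y]` of positive `y`-degree with top and
  bottom coefficients and `y`-discriminant not divisible by `F`, `c ∉ (F)`: EVERY irreducible
  surface `S` of dimension `≤ 2` containing the points `(x, y, e^{x₁})` with `x ∈ C`, `c(x) ≠ 0`,
  `y ≠ 0`, `P(x; y) = 0` has Zariski-dense exponential points.  (The place type is split as in file LXXXIV:
  a long row gives an unbounded place; otherwise the top row gives a bounded one; `x₁`-degree one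
  without a long row is a bounded rational graph.)
What this is NOT: `P` not separable modulo `F` (reduce to the squarefree part first — not done
here); fibre relations involving `y₁`; curves with transcendental coefficients; Fib(3,2); EC(3,2) —
OPEN; the question OPEN in general; NOT Schanuel's conjecture (neither used nor implied;
Lindemann's theorem enters through file LXXXIII); EAC ⇏ SC.
-/

noncomputable section

open Filter Topology Set Complex Polynomial
open Literature.NumberTheory.Transcendental Literature.ModelTheory.Zilber
open Literature.ModelTheory.ExponentialFields

set_option linter.dupNamespace false

namespace Summit.Schanuel.Schanuel.Theorems

section FibreCurveDensity

variable (F : ℂ[X][X])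

/-! ## Part A. Along an unbounded place of a curve over `ℚ̄` -/

/-- **Fibre curves along an unbounded place of a curve over `ℚ̄`: dense.**  `F ∈ ℚ̄[x₀][x₁]`
irreducible of positive `x₁`-degree containing no line; an unbounded place `x₀ = s^{-k}`,
`x₁ = Φ(s)s^{-M}` (`k, M ≥ 1`, `Φ(0) ≠ 0`); `P ∈ ℂ[x₀][x₁][y]` of positive `y`-degree with top
and bottom coefficients and `y`-discriminant not divisible by `F`; `S` irreducible closed of
dimension `≤ 2` containing `(x(s), y, e^{x₁(s)})` for every root `y` of `P(x(s); ·)`, `s` small.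
Then `S` has Zariski-dense exponential points. [cite: MantovaMasser2023, §1 Further remarks, p. 5
(the question, open in general)] (new) -/
theorem unprojectedDense_fibreCurve_algebraicCurve_place {S : Set (Fin 2 ⊕ Fin 2 → ℂ)}
    (hS : IsIrreducibleClosed ℂ S) (hdim : zariskiDim ℂ S ≤ (2 : ℕ)) (hFirr : Irreducible F)
    (hnc : ∀ m₀ m₁ a : ℂ, m₁ ≠ 0 →
      ∃ x₀ : ℂ, (F.map (Polynomial.evalRingHom x₀)).eval ((a - m₀ * x₀) / m₁) ≠ 0)
    (halg : ∀ i j, IsAlgebraic ℚ ((F.coeff j).coeff i)) (hn : 1 ≤ F.natDegree)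
    {k M : ℕ} (hk : 1 ≤ k) (hM : 1 ≤ M) {Φ : ℂ → ℂ} (hΦ : AnalyticAt ℂ Φ 0) (hΦ0 : Φ 0 ≠ 0)
    (hplace : ∀ᶠ s in 𝓝[≠] (0 : ℂ),
      (F.map (Polynomial.evalRingHom (s ^ k)⁻¹)).eval (Φ s * (s ^ M)⁻¹) = 0)
    (P : Polynomial ℂ[X][X]) (hd : 1 ≤ P.natDegree) (htop : ¬ F ∣ P.leadingCoeff)
    (hbot : ¬ F ∣ P.coeff 0)
    (hdisc : ¬ F ∣ Polynomial.resultant P (derivative P) P.natDegree (P.natDegree - 1))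
    (hsub : ∀ᶠ s in 𝓝[≠] (0 : ℂ), ∀ y : ℂ, y ≠ 0 →
      (P.map (Polynomial.eval₂RingHom (Polynomial.evalRingHom (s ^ k)⁻¹)
        (Φ s * (s ^ M)⁻¹))).eval y = 0 →
      (Sum.elim ![(s ^ k)⁻¹, Φ s * (s ^ M)⁻¹] ![y, Complex.exp (Φ s * (s ^ M)⁻¹)] :
        Fin 2 ⊕ Fin 2 → ℂ) ∈ S) :
    UnprojectedDense S := by
  classical
  obtain ⟨e, L, ψ, he, hψan, hψ0, hroot⟩ :=
    exists_fibreCurve_puiseuxRoot F hFirr hn hk M hΦ hplace P hd htop hbot hdisc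
  have hψne : ∀ᶠ σ in 𝓝 (0 : ℂ), ψ σ ≠ 0 := hψan.continuousAt.eventually_ne hψ0
  have he0 : e ≠ 0 := by omega
  have hpowT : Tendsto (fun σ : ℂ => σ ^ e) (𝓝[≠] (0 : ℂ)) (𝓝[≠] (0 : ℂ)) :=
    tendsto_nhdsWithin_iff.2 ⟨(tendsto_pow_nhds_zero e he).mono_left nhdsWithin_le_nhds,
      eventually_nhdsWithin_of_forall fun σ hσ => pow_ne_zero _ hσ⟩
  have hΦ' : AnalyticAt ℂ (fun σ : ℂ => Φ (σ ^ e)) 0 :=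
    hΦ.comp_of_eq (analyticAt_id.pow e) (by simp [zero_pow he0])
  have hΦ'0 : (fun σ : ℂ => Φ (σ ^ e)) 0 ≠ 0 := by
    show Φ (0 ^ e) ≠ 0
    rw [zero_pow he0]
    exact hΦ0
  refine unprojectedDense_branch_of_algebraicCurve F hS hdim hFirr hnc halg (k := e * k)
    (M := e * M) (Nat.mul_pos (by omega) (by omega)) (Nat.mul_pos (by omega) (by omega)) hΦ' hΦ'0
    ?_ L hψan hψ0 ?_
  · filter_upwards [hpowT.eventually hplace] with σ hσ
    rw [pow_mul, pow_mul]
    exact hσ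
  · filter_upwards [hpowT.eventually hsub, hroot, nhdsWithin_le_nhds hψne, self_mem_nhdsWithin]
      with σ hσ hr hψσ hσ0
    rw [pow_mul, pow_mul]
    exact hσ _ (mul_ne_zero hψσ (zpow_ne_zero _ hσ0)) hr

/-! ## Part B. Along a bounded place of any irreducible curve -/

/-- **Fibre curves along a bounded place: dense** (`F` irreducible of `x₁`-degree `≥ 2`, ANY
coefficients; place `x₀ = s^{-k}`, `x₁ = Φ(s)`; same hypotheses on `P`; `S` containing
`(x(s), y, e^{Φ(s)})` for every root `y`). [cite: MantovaMasser2023, §1 Further remarks, p. 5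
(the question, open in general)] (new) -/
theorem unprojectedDense_fibreCurve_boundedPlace {S : Set (Fin 2 ⊕ Fin 2 → ℂ)}
    (hS : IsIrreducibleClosed ℂ S) (hdim : zariskiDim ℂ S ≤ (2 : ℕ)) (hFirr : Irreducible F)
    (hn : 2 ≤ F.natDegree) {k : ℕ} (hk : 1 ≤ k) {Φ : ℂ → ℂ} (hΦ : AnalyticAt ℂ Φ 0)
    (hplace : ∀ᶠ s in 𝓝[≠] (0 : ℂ), (F.map (Polynomial.evalRingHom (s ^ k)⁻¹)).eval (Φ s) = 0)
    (P : Polynomial ℂ[X][X]) (hd : 1 ≤ P.natDegree) (htop : ¬ F ∣ P.leadingCoeff)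
    (hbot : ¬ F ∣ P.coeff 0)
    (hdisc : ¬ F ∣ Polynomial.resultant P (derivative P) P.natDegree (P.natDegree - 1))
    (hsub : ∀ᶠ s in 𝓝[≠] (0 : ℂ), ∀ y : ℂ, y ≠ 0 →
      (P.map (Polynomial.eval₂RingHom (Polynomial.evalRingHom (s ^ k)⁻¹) (Φ s))).eval y = 0 →
      (Sum.elim ![(s ^ k)⁻¹, Φ s] ![y, Complex.exp (Φ s)] : Fin 2 ⊕ Fin 2 → ℂ) ∈ S) :
    UnprojectedDense S := by
  classical
  have hplace0 : ∀ᶠ s in 𝓝[≠] (0 : ℂ),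
      (F.map (Polynomial.evalRingHom (s ^ k)⁻¹)).eval (Φ s * (s ^ 0)⁻¹) = 0 := by
    filter_upwards [hplace] with s hs
    rwa [pow_zero, inv_one, mul_one]
  obtain ⟨e, L, ψ, he, hψan, hψ0, hroot⟩ :=
    exists_fibreCurve_puiseuxRoot F hFirr (by omega) hk 0 hΦ hplace0 P hd htop hbot hdisc
  have hψne : ∀ᶠ σ in 𝓝 (0 : ℂ), ψ σ ≠ 0 := hψan.continuousAt.eventually_ne hψ0
  have he0 : e ≠ 0 := by omega
  have hpowT : Tendsto (fun σ : ℂ => σ ^ e) (𝓝[≠] (0 : ℂ)) (𝓝[≠] (0 : ℂ)) :=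
    tendsto_nhdsWithin_iff.2 ⟨(tendsto_pow_nhds_zero e he).mono_left nhdsWithin_le_nhds,
      eventually_nhdsWithin_of_forall fun σ hσ => pow_ne_zero _ hσ⟩
  have hΦ' : AnalyticAt ℂ (fun σ : ℂ => Φ (σ ^ e)) 0 :=
    hΦ.comp_of_eq (analyticAt_id.pow e) (by simp [zero_pow he0])
  refine unprojectedDense_boundedBranch F hS hdim hFirr hn (k := e * k) (Nat.mul_pos (by omega)
    (by omega)) hΦ' ?_ L hψan hψ0 ?_
  · filter_upwards [hpowT.eventually hplace] with σ hσ
    rw [pow_mul]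
    exact hσ
  · filter_upwards [hpowT.eventually hsub, hroot, nhdsWithin_le_nhds hψne, self_mem_nhdsWithin]
      with σ hσ hr hψσ hσ0
    rw [pow_zero, inv_one, mul_one] at hr
    rw [pow_mul]
    exact hσ _ (mul_ne_zero hψσ (zpow_ne_zero _ hσ0)) hr

/-- **Fibre curves along a bounded place, `x₁`-degree `≥ 1`** (`F` not horizontal:
`F(·, y) ≢ 0` for every `y`). [cite: MantovaMasser2023, §1 Further remarks, p. 5 (the question,
open in general)] (new) -/
theorem unprojectedDense_fibreCurve_boundedPlace' {S : Set (Fin 2 ⊕ Fin 2 → ℂ)}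
    (hS : IsIrreducibleClosed ℂ S) (hdim : zariskiDim ℂ S ≤ (2 : ℕ)) (hFirr : Irreducible F)
    (hF1 : 1 ≤ F.natDegree) (hFh : ∀ a : ℂ, ∃ c : ℂ, (F.map (Polynomial.evalRingHom c)).eval a ≠ 0)
    {k : ℕ} (hk : 1 ≤ k) {Φ : ℂ → ℂ} (hΦ : AnalyticAt ℂ Φ 0)
    (hplace : ∀ᶠ s in 𝓝[≠] (0 : ℂ), (F.map (Polynomial.evalRingHom (s ^ k)⁻¹)).eval (Φ s) = 0)
    (P : Polynomial ℂ[X][X]) (hd : 1 ≤ P.natDegree) (htop : ¬ F ∣ P.leadingCoeff)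
    (hbot : ¬ F ∣ P.coeff 0)
    (hdisc : ¬ F ∣ Polynomial.resultant P (derivative P) P.natDegree (P.natDegree - 1))
    (hsub : ∀ᶠ s in 𝓝[≠] (0 : ℂ), ∀ y : ℂ, y ≠ 0 →
      (P.map (Polynomial.eval₂RingHom (Polynomial.evalRingHom (s ^ k)⁻¹) (Φ s))).eval y = 0 →
      (Sum.elim ![(s ^ k)⁻¹, Φ s] ![y, Complex.exp (Φ s)] : Fin 2 ⊕ Fin 2 → ℂ) ∈ S) :
    UnprojectedDense S := by
  classical
  have hplace0 : ∀ᶠ s in 𝓝[≠] (0 : ℂ),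
      (F.map (Polynomial.evalRingHom (s ^ k)⁻¹)).eval (Φ s * (s ^ 0)⁻¹) = 0 := by
    filter_upwards [hplace] with s hs
    rwa [pow_zero, inv_one, mul_one]
  obtain ⟨e, L, ψ, he, hψan, hψ0, hroot⟩ :=
    exists_fibreCurve_puiseuxRoot F hFirr hF1 hk 0 hΦ hplace0 P hd htop hbot hdisc
  have hψne : ∀ᶠ σ in 𝓝 (0 : ℂ), ψ σ ≠ 0 := hψan.continuousAt.eventually_ne hψ0
  have he0 : e ≠ 0 := by omega
  have hpowT : Tendsto (fun σ : ℂ => σ ^ e) (𝓝[≠] (0 : ℂ)) (𝓝[≠] (0 : ℂ)) :=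
    tendsto_nhdsWithin_iff.2 ⟨(tendsto_pow_nhds_zero e he).mono_left nhdsWithin_le_nhds,
      eventually_nhdsWithin_of_forall fun σ hσ => pow_ne_zero _ hσ⟩
  have hΦ' : AnalyticAt ℂ (fun σ : ℂ => Φ (σ ^ e)) 0 :=
    hΦ.comp_of_eq (analyticAt_id.pow e) (by simp [zero_pow he0])
  refine unprojectedDense_boundedBranch' F hS hdim hFirr hF1 hFh (k := e * k)
    (Nat.mul_pos (by omega) (by omega)) hΦ' ?_ L hψan hψ0 ?_
  · filter_upwards [hpowT.eventually hplace] with σ hσ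
    rw [pow_mul]
    exact hσ
  · filter_upwards [hpowT.eventually hsub, hroot, nhdsWithin_le_nhds hψne, self_mem_nhdsWithin]
      with σ hσ hr hψσ hσ0
    rw [pow_zero, inv_one, mul_one] at hr
    rw [pow_mul]
    exact hσ _ (mul_ne_zero hψσ (zpow_ne_zero _ hσ0)) hr

/-! ## Part C. The bounded place of a rational graph -/

/-- The bounded place `x₀ = s⁻¹`, `x₁ = -U_b(s)s^{deg a - deg b}/U_a(s)` of the rational graph
`a(x₀)x₁ + b(x₀) = 0` (`a ≠ 0`, `deg b ≤ deg a`), as in file LXX. [folklore] -/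
theorem exists_boundedPlace_rationalGraph (a b : ℂ[X]) (ha0 : a ≠ 0)
    (hdeg : b.natDegree ≤ a.natDegree) :
    ∃ Φ : ℂ → ℂ, AnalyticAt ℂ Φ 0 ∧ ∀ᶠ s in 𝓝[≠] (0 : ℂ),
      ((Polynomial.C a * X + Polynomial.C b : ℂ[X][X]).map
        (Polynomial.evalRingHom (s ^ 1)⁻¹)).eval (Φ s) = 0 := by
  classical
  -- adapted from file LXX (`unprojectedDensityQuestion_rationalGraph_polyFibre`)
  obtain ⟨Ua, hUaan, hUa0, hUaev⟩ :=
    exists_polarForm_eval a (U := fun _ : ℂ => (1 : ℂ)) analyticAt_const le_rfl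
  obtain ⟨Ub, hUban, -, hUbev⟩ :=
    exists_polarForm_eval b (U := fun _ : ℂ => (1 : ℂ)) analyticAt_const le_rfl
  rw [one_pow, mul_one] at hUa0
  have hUa0' : Ua 0 ≠ 0 := by rw [hUa0]; exact Polynomial.leadingCoeff_ne_zero.2 ha0
  have hUane : ∀ᶠ s in 𝓝 (0 : ℂ), Ua s ≠ 0 := hUaan.continuousAt.eventually_ne hUa0'
  set Φ : ℂ → ℂ := fun s => -(Ub s * s ^ (a.natDegree - b.natDegree)) / Ua s with hΦ
  refine ⟨Φ, ((hUban.mul (analyticAt_id.pow _)).neg).div hUaan hUa0', ?_⟩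
  filter_upwards [self_mem_nhdsWithin, nhdsWithin_le_nhds hUane] with s hs0 hUas
  replace hs0 : s ≠ 0 := hs0
  rw [eval_rationalGraph, pow_one]
  have ha' := hUaev s hs0
  have hb' := hUbev s hs0
  rw [one_mul, one_mul] at ha' hb'
  rw [show (s⁻¹ : ℂ) = s⁻¹ ^ 1 by rw [pow_one], ha', hb']
  simp only [hΦ]
  have key : (s : ℂ) ^ (a.natDegree - b.natDegree) * s⁻¹ ^ a.natDegree = s⁻¹ ^ b.natDegree := by
    rw [inv_pow, inv_pow]
    have hsa : s ^ a.natDegree = s ^ (a.natDegree - b.natDegree) * s ^ b.natDegree := by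
      rw [← pow_add, Nat.sub_add_cancel hdeg]
    rw [hsa, mul_inv, ← mul_assoc, mul_inv_cancel₀ (pow_ne_zero _ hs0), one_mul]
  have h1 : Ua s * s⁻¹ ^ a.natDegree * (-(Ub s * s ^ (a.natDegree - b.natDegree)) / Ua s) =
      -(Ub s * (s ^ (a.natDegree - b.natDegree) * s⁻¹ ^ a.natDegree)) := by
    field_simp
  rw [h1, key]
  ring

/-! ## Part D. THE HEADLINE: every curve over `ℚ̄` that is not a line -/

/-- **Fibre curves over curves defined over `ℚ̄`: dense.**  `F ∈ ℚ̄[x₀][x₁]` irreducible of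
positive `x₁`-degree and not a line; `P ∈ ℂ[x₀][x₁][y]` of positive `y`-degree whose top and
bottom coefficients and `y`-discriminant are not divisible by `F`; `c ∉ (F)`.  Every irreducible
closed `S` of dimension `≤ 2` containing the points `(x₀, x₁, y, e^{x₁})` with `F(x) = 0`,
`c(x) ≠ 0`, `y ≠ 0`, `P(x; y) = 0` has Zariski-dense exponential points. [cite: MantovaMasser2023,
§1 Further remarks, p. 5 (the question, open in general)] (new) -/
theorem unprojectedDense_fibreCurve_algebraicCurve (hFirr : Irreducible F) (hF1 : 1 ≤ F.natDegree)
    (hnl : F.natDegree = 1 → 1 ≤ F.leadingCoeff.natDegree ∨ 2 ≤ (F.coeff 0).natDegree)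
    (halg : ∀ i j, IsAlgebraic ℚ ((F.coeff j).coeff i))
    (P : Polynomial ℂ[X][X]) (hd : 1 ≤ P.natDegree) (htop : ¬ F ∣ P.leadingCoeff)
    (hbot : ¬ F ∣ P.coeff 0)
    (hdisc : ¬ F ∣ Polynomial.resultant P (derivative P) P.natDegree (P.natDegree - 1))
    (c : ℂ[X][X]) (hc : ¬ F ∣ c) {S : Set (Fin 2 ⊕ Fin 2 → ℂ)} (hS : IsIrreducibleClosed ℂ S)
    (hdim : zariskiDim ℂ S ≤ (2 : ℕ))
    (hsub : ∀ x₀ x₁ y : ℂ, (F.map (Polynomial.evalRingHom x₀)).eval x₁ = 0 →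
      (c.map (Polynomial.evalRingHom x₀)).eval x₁ ≠ 0 → y ≠ 0 →
      (P.map (Polynomial.eval₂RingHom (Polynomial.evalRingHom x₀) x₁)).eval y = 0 →
      (Sum.elim ![x₀, x₁] ![y, Complex.exp x₁] : Fin 2 ⊕ Fin 2 → ℂ) ∈ S) :
    UnprojectedDense S := by
  classical
  have hnc := planeCurve_not_contains_line_of_notLine F hFirr hF1 hnl
  by_cases hlong : ∃ j, j < F.natDegree ∧ F.leadingCoeff.natDegree < (F.coeff j).natDegree
  · -- an unbounded place over `x₀ = ∞`
    obtain ⟨k, M, Φ, hk, hM, hΦan, hΦ0, hplace⟩ :=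
      exists_place_atInfinity_of_longRow F hFirr hF1 hlong
    obtain ⟨ψc, Lc, hψcan, hψc0, hcev⟩ :=
      exists_rows_place_normalForm F hFirr hF1 c hc hk M hΦan hplace
    refine unprojectedDense_fibreCurve_algebraicCurve_place F hS hdim hFirr hnc halg hF1 hk hM hΦan
      hΦ0 hplace P hd htop hbot hdisc ?_
    filter_upwards [hplace, hcev, nhdsWithin_le_nhds (hψcan.continuousAt.eventually_ne hψc0),
      self_mem_nhdsWithin] with s hs hcs hψs hs0 y hy0 hy
    replace hs0 : s ≠ 0 := hs0
    refine hsub _ _ y hs ?_ hy0 hy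
    rw [hcs]
    exact mul_ne_zero hψs (zpow_ne_zero _ hs0)
  · push Not at hlong
    by_cases hn : 2 ≤ F.natDegree
    · -- no long row: the top row at level `deg lc` gives a bounded place
      set N : ℕ := F.leadingCoeff.natDegree with hNdef
      have hN : ∀ j, (F.coeff j).natDegree ≤ N := by
        intro j
        by_cases hj : j < F.natDegree
        · exact hlong j hj
        · by_cases hj' : j = F.natDegree
          · rw [hj']
            exact le_rfl
          · rw [Polynomial.coeff_eq_zero_of_natDegree_lt (by omega), Polynomial.natDegree_zero]
            exact Nat.zero_le _
      set T : ℂ[X] := ∑ j ∈ Finset.range (F.natDegree + 1),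
        Polynomial.monomial j ((F.coeff j).coeff N) with hTdef
      have hT : ∀ j, T.coeff j = (F.coeff j).coeff N := by
        intro j
        rw [hTdef, Polynomial.finsetSum_coeff]
        simp only [Polynomial.coeff_monomial, Finset.sum_ite_eq', Finset.mem_range]
        split_ifs with h
        · rfl
        · rw [Polynomial.coeff_eq_zero_of_natDegree_lt (p := F) (by omega), Polynomial.coeff_zero]
      have hTn : T.coeff F.natDegree ≠ 0 := by
        rw [hT, Polynomial.coeff_natDegree]
        exact Polynomial.leadingCoeff_ne_zero.2 (Polynomial.leadingCoeff_ne_zero.2 hFirr.ne_zero)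
      have hT0 : T ≠ 0 := fun h => hTn (by rw [h, Polynomial.coeff_zero])
      have hTdeg : T.degree ≠ 0 := by
        intro h0
        have hle := Polynomial.le_natDegree_of_ne_zero hTn
        rw [Polynomial.degree_eq_natDegree hT0] at h0
        have h00 : T.natDegree = 0 := by exact_mod_cast h0
        rw [h00] at hle
        omega
      obtain ⟨θ, hθ⟩ := IsAlgClosed.exists_root T hTdeg
      obtain ⟨k, Φ, hk, hΦan, -, hplace⟩ :=
        exists_fibreCycle_puiseux F hFirr (by omega) N hN T hT hT0 hθ
      have hplace0 : ∀ᶠ s in 𝓝[≠] (0 : ℂ),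
          (F.map (Polynomial.evalRingHom (s ^ k)⁻¹)).eval (Φ s * (s ^ 0)⁻¹) = 0 := by
        filter_upwards [hplace] with s hs
        rwa [pow_zero, inv_one, mul_one]
      obtain ⟨ψc, Lc, hψcan, hψc0, hcev⟩ :=
        exists_rows_place_normalForm F hFirr hF1 c hc hk 0 hΦan hplace0
      refine unprojectedDense_fibreCurve_boundedPlace F hS hdim hFirr hn hk hΦan hplace P hd htop
        hbot hdisc ?_
      filter_upwards [hplace, hcev, nhdsWithin_le_nhds (hψcan.continuousAt.eventually_ne hψc0),
        self_mem_nhdsWithin] with s hs hcs hψs hs0 y hy0 hy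
      replace hs0 : s ≠ 0 := hs0
      rw [pow_zero, inv_one, mul_one] at hcs
      refine hsub _ _ y hs ?_ hy0 hy
      rw [hcs]
      exact mul_ne_zero hψs (zpow_ne_zero _ hs0)
    · -- `x₁`-degree one without a long row: a bounded rational graph
      have h1 : F.natDegree = 1 := by omega
      have hlc : F.leadingCoeff = F.coeff 1 := by rw [Polynomial.leadingCoeff, h1]
      have hFeq : F = Polynomial.C (F.coeff 1) * Polynomial.X + Polynomial.C (F.coeff 0) :=
        Polynomial.eq_X_add_C_of_natDegree_le_one (le_of_eq h1)
      have hdegb : (F.coeff 0).natDegree ≤ (F.coeff 1).natDegree := by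
        rw [← hlc]
        exact hlong 0 (by omega)
      have hα : 1 ≤ (F.coeff 1).natDegree := by
        rcases hnl h1 with h | h
        · rwa [hlc] at h
        · omega
      have ha0 : F.coeff 1 ≠ 0 := by
        rw [← hlc]
        exact Polynomial.leadingCoeff_ne_zero.2 hFirr.ne_zero
      have hirr' : Irreducible
          (Polynomial.C (F.coeff 1) * Polynomial.X + Polynomial.C (F.coeff 0) : ℂ[X][X]) := by
        rw [← hFeq]; exact hFirr
      obtain ⟨Φ, hΦan, hplace⟩ := exists_boundedPlace_rationalGraph (F.coeff 1) (F.coeff 0) ha0 hdegb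
      rw [← hFeq] at hplace
      have hFh : ∀ a : ℂ, ∃ c : ℂ, (F.map (Polynomial.evalRingHom c)).eval a ≠ 0 := by
        intro y
        obtain ⟨x, hx⟩ := rationalGraph_not_horizontal (F.coeff 1) (F.coeff 0) hirr' hα y
        exact ⟨x, by rw [hFeq]; exact hx⟩
      have hplace0 : ∀ᶠ s in 𝓝[≠] (0 : ℂ),
          (F.map (Polynomial.evalRingHom (s ^ 1)⁻¹)).eval (Φ s * (s ^ 0)⁻¹) = 0 := by
        filter_upwards [hplace] with s hs
        rwa [pow_zero, inv_one, mul_one]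
      obtain ⟨ψc, Lc, hψcan, hψc0, hcev⟩ :=
        exists_rows_place_normalForm F hFirr hF1 c hc le_rfl 0 hΦan hplace0
      refine unprojectedDense_fibreCurve_boundedPlace' F hS hdim hFirr hF1 hFh le_rfl hΦan hplace P
        hd htop hbot hdisc ?_
      filter_upwards [hplace, hcev, nhdsWithin_le_nhds (hψcan.continuousAt.eventually_ne hψc0),
        self_mem_nhdsWithin] with s hs hcs hψs hs0 y hy0 hy
      replace hs0 : s ≠ 0 := hs0
      rw [pow_zero, inv_one, mul_one] at hcs
      refine hsub _ _ y hs ?_ hy0 hy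
      rw [hcs]
      exact mul_ne_zero hψs (zpow_ne_zero _ hs0)

end FibreCurveDensity

end Summit.Schanuel.Schanuel.Theorems
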